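import Mathlib.Analysis.Calculus.DifferentialForm.Basic
import Literature.Geometry.Symplectic.StandardEnd
import HarnessLib

/-!
# The flat birth pair: an asymptotically standard near-symplectic form on `ℝ⁴` with two untwisted
# zero circles in Taubes–Honda model position

Trunk `Literature/Geometry/Symplectic` (next to `NearSymplecticPuncturedSphere.lean`, whose named
fact `relNearSymplecticTaubesTubes_exists` is the same statement on a punctured homotopy `4`-sphere,
and to the near-symplectic vocabulary files `NearSymplecticForms.lean`,
`NearSymplecticZeroCircles.lean`, `HondaModelNearSymplectic.lean`,
`NearSymplecticTwoCirclesReduction(Strict).lean`).  Named fact (D-0014) requested by route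
`SmoothPoincare4/SullivanDual`, crux `HyperbolicEnd` (`stmt-SmoothPoincare4-7825`), line
`taubes-circle-pencil`, stub SM `stub_modelFoliation`: it is the DATA HALF of that stub (the
package `IsFlatNearSymplecticData` of
`Summits/SmoothPoincare4/SmoothPoincare4/Theorems/SullivanDualHyperbolicEndTaubesModelDefs.lean`
with its `taubesForm` / `taubesTube` / `taubesCore` unfolded, Literature cannot import Summits),
stated over plain calculus on `ℝ⁴ = EuclideanSpace ℝ (Fin 4)` (`ContDiff`, Mathlib's `extDeriv`,
`fderiv`) and `Literature.Geometry.Symplectic.stdSymplecticForm` (`StandardEnd.lean`).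

## The printed results and the derivation being packaged

1. **A pair of even zero circles is born in a Darboux ball (Perutz 2006, Prop. 1.5 with its
   proof, and Rem. 1.9).**  "Let `ω` be a near-symplectic form on an oriented four-manifold whose
   zero-set has `n ≥ 0` components.  Then there is a near-symplectic form whose zero-set has `n + 2`
   components and which coincides with `ω` outside an embedded ball."  Proof in print: the forms
   `ω_{f,g} = df ∧ dt + ⋆_g df` on `S¹ × ℝ³` are closed iff `df` is `g`-coclosed, near-symplectic
   with zero circles `S¹ × Crit(f)` when `f` is Morse, and `ω_{x₃, g₀}` is standard; Calabi (1969)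
   modifies `f₀ = x₃` inside a ball to `f₁` with `df₁` coclosed for a metric `g₁` standard outside
   the ball (a cancelling pair of critical points of indices `1`, `2`); plug `ω_{f₁,g₁}` into a
   neighbourhood of a loop in a Darboux ball.  Rem. 1.9: "Pairs of EVEN circles can then be
   introduced as in the proposition above" (the `S¹`-invariant model has trivial eigen-line bundle
   `L⁻`, Perutz Prop. 2.2; = Honda's orientable type (A), Gay–Kirby 2004 Rem. 3).  Applied to
   `(ℝ⁴, ω₀)` (`n = 0`): a smooth closed `2`-form on `ℝ⁴`, equal to `ω₀ = stdSymplecticForm` off a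
   ball `B_R`, symplectic off its zero set, the zero set being exactly two disjoint even
   (= untwisted) circles inside `B_R`, along each of which the form is `df₁ ∧ dt + ⋆_{g₁} df₁` with
   `f₁` Morse — in particular self-dual and transverse for the metric `dt² + g₁` there (a
   "definite" near-symplectic form in the sense of `NearSymplecticDefinite.lean`; Perutz Lemma 2.1).
2. **Exact local model along an untwisted circle (Honda 2004, §4 Thm. 4 (A) and Thm. 5; Taubes
   1998, §1.c; re-proved for arcs as Perutz 2006, Lemma 3.1 with footnote).**  "Given an SD
   harmonic 2-form `ω`, there exists a 1-parameter family of perturbations `{ω_t}`, local near `C`,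
   such that `ω₀ = ω`, `ω₁|_{N(C)}` is one of the two local forms" — for an even circle the
   `S¹`-invariant form `ω_A = ⋆₃ dQ + dθ ∧ dQ`, `Q = ½(x₁² + x₂²) − x₃²`, on `(ℝ/2πℤ) × D³(r)` with
   the product flat metric; Taubes 1998 §1.c: the homotopy is "through forms with fixed,
   non-degenerate vanishing set which are symplectic on the complement", with "non-trivial support
   in any given neighbourhood of the fixed vanishing set", ending at a form that "agrees with (1.2)'s
   form" `dt ∧ (x dx + y dy − 2z dz) + x dy∧dz − y dx∧dz − 2z dx∧dy` (= `ω_A`) near the circle.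
   The deformation — not a mere change of coordinates — is essential: Moser's method alone gives an
   identification that is only `C¹`/Lipschitz along the circle (Honda 2004 Thm. 2 and proof of
   Thm. 5; Perutz 2006 §3 footnote), and it absorbs the length of the circle (`c·ω_A ≇ ω_A`; the
   convex interpolation `θ_s = (1 − s)ω + s·ω_A` of Perutz's step 1 reaches any positive multiple).
   Applied inside two disjoint small neighbourhoods of the two circles of step 1 (inside `B_R`, so
   the form stays `ω₀` on `{R ≤ ‖y‖}` and symplectic off the unchanged zero set): smooth
   orientation-compatible embeddings `χᵢ : (ℝ/2πℤ) × D³(r) → B_R` with `χᵢ* sf = ω_A`,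
   `χᵢ(S¹ × 0)` = the `i`-th circle.
3. **Flat toroidal coordinates (elementary; `ToroidalCoordinates.lean` has the same map for the
   manifold-side fact).**  For `0 < δ < 1`, `T(y) = (arg(y₀ + iy₁), √(y₀² + y₁²) − 1, y₂, y₃)` is a
   diffeomorphism of the open solid torus `U_δ = {(√(y₀² + y₁²) − 1)² + y₂² + y₃² < δ²} ⊂ ℝ⁴` onto
   `(ℝ/2πℤ) × D³(δ)` carrying the core circle `C₀ = {y₀² + y₁² = 1, y₂ = y₃ = 0}` onto `S¹ × {0}`,
   with `T*dθ = (y₀ dy₁ − y₁ dy₀)/(y₀² + y₁²)`, `T*dx₁ = (y₀ dy₀ + y₁ dy₁)/√(y₀² + y₁²)`,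
   `T*dx₂ = dy₂`, `T*dx₃ = dy₃`; hence `T*ω_A` is the explicit function `formT y u v` below
   (`dt ∧ dQ + a db∧dc + b dc∧da − 2c da∧db` on flat vectors `u, v` at `y`, `a = √(y₀²+y₁²) − 1`,
   `b = y₂`, `c = y₃`; character for character the sibling's `formT` and the Summit's `taubesForm`).
   With `δ ≤ r`, `Ψᵢ := χᵢ ∘ T` on `U_δ` (extended arbitrarily off `U_δ`) are smooth injective
   immersions into `B_R` with `Ψᵢ* sf = formT`; the two tube images are disjoint for small `δ`.
4. The resulting `sf` is smooth and closed on `ℝ⁴` (`extDeriv sf = 0`), equal to `ω₀` on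
   `{R ≤ ‖y‖}`, and non-degenerate at every point off `Ψ₁(C₀) ∪ Ψ₂(C₀)` (inside the tubes it is
   the model, which vanishes exactly on the core; elsewhere it is symplectic).

Only the END RESULT of 1–4 is recorded, as the named fact `flatNearSymplecticTaubesTubes_exists`
(nothing is asserted; users take it as a hypothesis).  A future split along the lines of
`NearSymplecticTwoCirclesReduction.lean` would isolate the one genuinely non-elementary printed
input that is specific to this file — step 1, Perutz's Prop. 1.5 / Rem. 1.9 on `(ℝ⁴, ω₀)`:
"there is an `IsStrictlyNearSymplectic` form on `ℝ⁴` equal to `ω₀` off a ball whose zero locus is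
the disjoint union of two even zero circles" — from step 2 (Honda's normal form, the hypothesis
`(H)` of that file read on `M = ℝ⁴`) and the flat analogue of its toroidal glue.

## Design notes

* Plain calculus, not `MForm`: the Summit package `IsFlatNearSymplecticData` is phrased with
  `ContDiff ℝ ∞ sf`, `extDeriv sf = 0`, `fderiv`; on the vector space `ℝ⁴` these agree with
  `IsSmoothForm` / `IsClosedForm` / `mfderiv` of `ManifoldForms.lean`, but stating the fact in the
  consumer's terms keeps the staging theorem definitional (as for the sibling, whose staging helper
  `helper_nearSymplecticData_of_relNearSymplecticTaubesTubes` is by structure-instance unification).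
* Orientations never enter (`formT ∧ formT = −(2/r)(a² + b² + 4c²) dy₀₁₂₃`: `T` reverses
  orientation; the tube maps are free data).  Junk values: `x / 0 = 0` on the axis `y₀ = y₁ = 0`,
  which `U_δ` misses for `δ < 1`; `Ψᵢ` are total functions constrained only on `U_δ`.
* Non-degeneracy is asked off the two CORE circles (the printed zero set); the Summit package asks
  it only off the tubes.
* Searched (`lean search` / grep, 2026-08-17): `flatNearSymplectic`, `birth`, `Calabi`,
  `Prop. 1.5`, `evenPair` in `Literature/Geometry/Symplectic` — only docstring mentions in
  `NearSymplecticPuncturedSphere.lean`; the near-symplectic vocabulary files landed the same day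
  (`NearSymplecticForms`, `NearSymplecticZeroCircles`, `HondaModelNearSymplectic`,
  `NearSymplecticDefinite`, the two `…Reduction` files) concern `M ∖ p` and introduce no flat
  existence statement.

## References

* T. Perutz, *Zero-sets of near-symplectic forms*, J. Symplectic Geom. 4 (2006) 237–257,
  arXiv:math/0601320, Prop. 1.5 (with proof), Rem. 1.9, Lemma 2.1, Prop. 2.2, §3 and Lemma 3.1
  [Perutz2006].
* E. Calabi, *An intrinsic characterization of harmonic one-forms*, in: Global Analysis (Papers
  in Honor of K. Kodaira), Univ. Tokyo Press (1969) 101–117 (the modification `x₃ ↦ f₁` used in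
  Perutz's proof) [Calabi1969HarmonicOneForms].
* K. Honda, *Local properties of self-dual harmonic 2-forms on a 4-manifold*, J. reine angew.
  Math. 577 (2004) 105–116, arXiv:dg-ga/9705010, §4 Thm. 4 (A), Thm. 5 [Honda2004LocalSD].
* C. H. Taubes, *The structure of pseudo-holomorphic subvarieties for a degenerate almost complex
  structure and symplectic form on `S¹ × B³`*, Geom. Topol. 2 (1998) 221–332, eq. (1.1)–(1.2),
  §1.c [Taubes1998S1B3].
* D. T. Gay, R. Kirby, *Constructing symplectic forms on 4-manifolds which vanish on circles*,
  Geom. Topol. 8 (2004) 743–777, Rem. 3 (the orientable = untwisted local model)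
  [GayKirby2004CirclesGT].
-/

noncomputable section

open scoped ContDiff
open Set

namespace Literature.Geometry.Symplectic

/-- Local notation for the model space `ℝ⁴ = EuclideanSpace ℝ (Fin 4)`. -/
local notation "E4" => EuclideanSpace ℝ (Fin 4)

/-- **The flat birth pair with Taubes tubes (Perutz 2006 Prop. 1.5 / Rem. 1.9 + Honda 2004 Thm. 5
+ Taubes 1998 §1.c, end result).**  There are `R > 0`, `0 < δ < 1`, a `C^∞` `2`-form `sf` on `ℝ⁴`
(a map `ℝ⁴ → (ℝ⁴ [⋀^Fin 2]→L[ℝ] ℝ)`) which is closed (`extDeriv sf = 0`) and equal to the standard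
symplectic form `ω₀ = stdSymplecticForm` at every point of `{R ≤ ‖y‖}` (asymptotically standard),
and two maps `Ψ₁, Ψ₂ : ℝ⁴ → ℝ⁴` which on the flat solid torus
`U_δ = {(√(y₀² + y₁²) − 1)² + y₂² + y₃² < δ²}` are `C^∞` injective immersions into the open ball
`{‖·‖ < R}` with disjoint images, pulling `sf` back to Taubes' untwisted model
`formT = dt ∧ dQ + ⋆₃ dQ` (`Q = ½(a² + b² − 2c²)`, `t = arg(y₀ + iy₁)`, `a = √(y₀² + y₁²) − 1`,
`b = y₂`, `c = y₃`; = Honda's `ω_A`, `θ` of period `2π`, = Taubes 1998 eq. (1.1), written on flat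
vectors `u, v` at `y`), and such that `sf` is non-degenerate at every point off the two core
circles `Ψᵢ(C₀)`, `C₀ = {y₀² + y₁² = 1, y₂ = y₃ = 0}` (so `sf` is near-symplectic on `ℝ⁴`,
standard at infinity, with zero set exactly two untwisted circles in model position: the
Luttinger–Simpson / Calabi–Perutz birth pair).  Derivation from the cited statements: module
docstring, steps 1–4.  Nothing is asserted; users take `(h : flatNearSymplecticTaubesTubes_exists)`.
[cite: Perutz2006, Prop. 1.5 (with proof), Rem. 1.9, Lemma 2.1, §3 and Lemma 3.1]
[cite: Honda2004LocalSD, §4 Thm. 4 (A) and Thm. 5]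
[cite: Taubes1998S1B3, eq. (1.1)–(1.2) and §1.c]
[cite: Calabi1969HarmonicOneForms, the example modifying x₃ (via Perutz2006 Prop. 1.5)] -/
def flatNearSymplecticTaubesTubes_exists : Prop :=
  ∃ (R δ : ℝ) (sf : E4 → E4 [⋀^Fin 2]→L[ℝ] ℝ) (Ψ₁ Ψ₂ : E4 → E4),
    -- the flat solid torus `U_δ` and its core circle `C₀`
    let U : Set E4 := {y | (Real.sqrt (y 0 ^ 2 + y 1 ^ 2) - 1) ^ 2 + y 2 ^ 2 + y 3 ^ 2 < δ ^ 2}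
    let C : Set E4 := {y | y 0 ^ 2 + y 1 ^ 2 = 1 ∧ y 2 = 0 ∧ y 3 = 0}
    -- toroidal coframe: `r = √(y₀² + y₁²)`, `dt = (y₀ dy₁ − y₁ dy₀)/r²`, `da = dr`,
    -- `dQ = a da + b db − 2c dc` (`a = r − 1`, `b = y₂`, `c = y₃`)
    let r : E4 → ℝ := fun y => Real.sqrt (y 0 ^ 2 + y 1 ^ 2)
    let dt : E4 → E4 → ℝ := fun y u => (y 0 * u 1 - y 1 * u 0) / r y ^ 2
    let da : E4 → E4 → ℝ := fun y u => (y 0 * u 0 + y 1 * u 1) / r y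
    let dQ : E4 → E4 → ℝ := fun y u => (r y - 1) * da y u + y 2 * u 2 - 2 * y 3 * u 3
    -- Taubes' untwisted model `dt ∧ dQ + a db∧dc + b dc∧da − 2c da∧db` on flat vectors `u, v`
    let formT : E4 → E4 → E4 → ℝ := fun y u v =>
      dt y u * dQ y v - dt y v * dQ y u
        + (r y - 1) * (u 2 * v 3 - v 2 * u 3)
        + y 2 * (u 3 * da y v - v 3 * da y u)
        - 2 * y 3 * (da y u * v 2 - da y v * u 2)
    -- a flat Taubes tube of `sf` inside `B_R`: a smooth injective immersion of `U_δ` into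
    -- `{‖·‖ < R}` with `Ψ* sf = formT`
    let IsTube : (E4 → E4) → Prop := fun Ψ =>
      ContDiffOn ℝ ∞ Ψ U ∧ Set.InjOn Ψ U ∧
        (∀ y ∈ U, Function.Injective (fderiv ℝ Ψ y)) ∧
        (∀ y ∈ U, ‖Ψ y‖ < R) ∧
        (∀ y ∈ U, ∀ u v : E4, sf (Ψ y) ![fderiv ℝ Ψ y u, fderiv ℝ Ψ y v] = formT y u v)
    0 < R ∧ 0 < δ ∧ δ < 1 ∧
    ContDiff ℝ ∞ sf ∧ extDeriv sf = 0 ∧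
    (∀ y : E4, R ≤ ‖y‖ → ∀ a b : E4, sf y ![a, b] = stdSymplecticForm a b) ∧
    IsTube Ψ₁ ∧ IsTube Ψ₂ ∧ Disjoint (Ψ₁ '' U) (Ψ₂ '' U) ∧
    ∀ y : E4, y ∉ Ψ₁ '' C ∪ Ψ₂ '' C → ∀ a : E4, a ≠ 0 → ∃ b : E4, sf y ![a, b] ≠ 0

end Literature.Geometry.Symplectic

end
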